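import Mathlib
import Summits.NavierStokesRegularity.NavierStokesRegularity.Theorems.LerayQuarterDissipationFiniteDissipationLiouvilleThresholdKLimit
import Summits.NavierStokesRegularity.NavierStokesRegularity.Theorems.LerayQuarterDissipationFiniteDissipationLiouvilleCriticalElement
import Summits.NavierStokesRegularity.NavierStokesRegularity.Theorems.LerayQuarterDissipationFiniteDissipationLiouvilleEnvelope
import Summits.NavierStokesRegularity.NavierStokesRegularity.Theorems.LerayQuarterDissipationFiniteDissipationLiouvilleCalmSliceForward
import Summits.NavierStokesRegularity.NavierStokesRegularity.Theorems.LerayQuarterDissipationFiniteDissipationLiouvilleSmallDissipationGapSharper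
import Literature.Analysis.FluidPDE.CurlFreeLiouville
import HarnessLib

/-!
# The dissipation threshold of the finite-dissipation stratum, file 6: NO SINGULAR MEMBER AT OR
  BELOW THE THRESHOLD `θ(K)⁴ = 64/27`, AND THE GAP ABOVE IT (route `LerayQuarterDissipation`, crux
  `FiniteDissipationLiouville` stmt-NavierStokesRegularity-22144; lead prover g14, helper — the
  `K`-direction analogue of `…ThresholdOne`)

HONEST FRAMING. A Liouville statement about a HYPOTHETICAL class — Type-I ancient mild solutions in
the Koch–Nadirashvili–Seregin–Šverák gauge with the quarter-rate dissipation law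
`∫‖∇u(s)‖² ≤ K/√(−s)`. It PROVES THE CRUX IN A FURTHER REGION OF ITS PARAMETER PLANE: the explicit
small-dissipation rung `θ(K)⁴ < 64/27` (`θ(K) = √(max K 0)(√K_S)³`, `…SmallDissipationGapSharper`) is
NOT attained — no singular member has `θ(K)⁴ = 64/27` — and by compactness the crux holds for
`θ(K)⁴ ≤ 64/27 + ε(C)`, some ineffective `ε(C) > 0`. Nothing for larger `K`; NOTHING about
Navier–Stokes regularity or blow-up; no summit is proved.

PROOF. `not_singular_of_theta4_le`: a singular member yields a CRITICAL element `W ∈ 𝒟_{C,K_c}`,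
`K_c ≤ K` (`CriticalElement.exists_minimal_singular`); if `K_c ≤ 0` or `θ(K_c)⁴ < 64/27` the sharper
rung kills it; otherwise `…ThresholdKLimit.exists_singular_limit_twoValued` gives a SINGULAR
`V ∈ 𝒟_{C,K_c}` whose vorticity modulus at `t = −1` is two-valued, hence zero
(`ThresholdK.eq_zero_of_twoValued_normSq`, `∫‖Ω‖² < ∞` by scale invariance); a curl- and divergence-free
bounded slice is constant (`eq_of_curl_eq_zero_of_isDivFree_of_bounded`), the envelope of the critical
stratum (`Envelope.envelope_of_minimal`) makes the constant `0`, and a member with a zero slice is not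
singular (`CalmSlice.not_singular_of_zero_slice`). `exists_dissipation_gap`: if singular members
existed with `θ(K_n)⁴ ↓ 64/27`, KNSS compactness (`Compactness.seqLimit`, `law_of_seqLimit`,
`persistent_singularity_seq`) would produce one AT the threshold.
[cite: KochNadirashviliSereginSverak2009, §4 (arXiv:0709.3599 p. 8)]
-/

noncomputable section

set_option linter.dupNamespace false

namespace Summit.NavierStokesRegularity.NavierStokesRegularity.Theorems.FiniteDissipationLiouville.ThresholdK

open MeasureTheory Set Filter Topology Metric Function Real
open scoped ContDiff
open Literature.Analysis Literature.Analysis.FluidPDE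
open Summit.NavierStokesRegularity.NavierStokesRegularity.Theorems
open Summit.NavierStokesRegularity.NavierStokesRegularity.Theorems.FiniteDissipationLiouville

/-- **NO FINITE-DISSIPATION TYPE-I SINGULARITY AT OR BELOW THE DISSIPATION THRESHOLD.** A Type-I
ancient mild field in the KNSS gauge (constant `C`) with the quarter-rate dissipation law
`∫‖∇u(s)‖² ≤ K/√(−s)` and `(√(max K 0)(√K_S)³)⁴ ≤ 64/27` is bounded on some backward parabolic
cylinder at the origin. (Critical element; equality case of Hölder on a singular KNSS limit; a
continuous square-integrable vorticity with two-valued modulus vanishes; curl-free Liouville;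
envelope; forward uniqueness.) [cite: KochNadirashviliSereginSverak2009, §4 (arXiv:0709.3599 p. 8)] -/
theorem not_singular_of_theta4_le {C K : ℝ}
    {u : ℝ → EuclideanSpace ℝ (Fin 3) → EuclideanSpace ℝ (Fin 3)} (hu : IsTypeIAncientMild C u)
    (hlaw : ∀ s : ℝ, s < 0 → ∫⁻ x, ‖fderiv ℝ (u s) x‖ₑ ^ 2 ≤ ENNReal.ofReal (K / Real.sqrt (-s)))
    (hθ : (Real.sqrt (max K 0) *
      Real.sqrt (SNormLESNormFDerivOfEqConst (EuclideanSpace ℝ (Fin 3))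
        (volume : Measure (EuclideanSpace ℝ (Fin 3))) 2 : ℝ) ^ 3) ^ 4 ≤ 64 / 27) :
    ¬ (∀ r > 0, ∀ M : ℝ, ∃ t ∈ Ioo (-(r ^ 2)) (0 : ℝ),
      ∃ x ∈ ball (0 : EuclideanSpace ℝ (Fin 3)) r, M < ‖u t x‖) := by
  intro hsing
  set k3 : ℝ := Real.sqrt (SNormLESNormFDerivOfEqConst (EuclideanSpace ℝ (Fin 3))
    (volume : Measure (EuclideanSpace ℝ (Fin 3))) 2 : ℝ) ^ 3 with hk3
  have hk30 : 0 ≤ k3 := by positivity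
  -- ### the critical element
  obtain ⟨Kc, hKcK, ⟨W, hW, hWlaw, hWsing⟩, hmin⟩ := CriticalElement.exists_minimal_singular hu hlaw hsing
  have hθc : (Real.sqrt (max Kc 0) * k3) ^ 4 ≤ 64 / 27 := by
    refine le_trans ?_ hθ
    exact pow_le_pow_left₀ (by positivity)
      (mul_le_mul_of_nonneg_right (Real.sqrt_le_sqrt (max_le_max hKcK le_rfl)) hk30) 4
  by_cases hKc0 : Kc ≤ 0
  · -- `θ(K_c) = 0`: the explicit rung applies
    have hlt : (Real.sqrt (max Kc 0) * k3) ^ 4 < 64 / 27 := by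
      rw [max_eq_right hKc0, Real.sqrt_zero, zero_mul]; norm_num
    exact SmallDissipationGap.not_singular_of_small_dissipation_sharper hW hWlaw hlt hWsing
  push Not at hKc0
  -- ### the two-valued singular limit and the envelope of the critical stratum
  obtain ⟨V, hV, hVlaw, hVsing, γ, hγ, htwo⟩ := exists_singular_limit_twoValued hKc0 hW hWlaw hθc hWsing
  obtain ⟨A, hA0, henv⟩ := Envelope.envelope_of_minimal hmin
  have hVenv : HasTypeIDecay A V := henv V hV hVlaw hVsing
  set U : EuclideanSpace ℝ (Fin 3) → EuclideanSpace ℝ (Fin 3) := V (-1) with hUdef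
  set Ω : EuclideanSpace ℝ (Fin 3) → EuclideanSpace ℝ (Fin 3) := curl U with hΩdef
  have hUs : ContDiff ℝ ∞ U := hV.contDiff_slice (by norm_num)
  have hU2 : ContDiff ℝ 2 U := hUs.of_le (by norm_cast)
  have hΩ1 : ContDiff ℝ 1 Ω := contDiff_curl (hUs.of_le (by norm_cast))
  -- `∫‖Ω‖² < ∞` (scale invariance of the law)
  have hΩint : Integrable (fun y => ‖Ω y‖ ^ 2) := by
    have h := (SmallDissipationGap.integrable_sq_norm_lerayVorticity hV hVlaw 0).1
    rw [lerayVorticity_apply, ThresholdOne.lerayOrbit_zero] at h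
    exact h
  -- ### two-valued ⇒ `Ω ≡ 0` ⇒ `U` constant ⇒ `U ≡ 0` ⇒ not singular
  have hΩ0 : ∀ y, Ω y = 0 := eq_zero_of_twoValued_normSq hΩ1.continuous hΩint hγ.2 htwo
  have hdivU : VectorCalculus.IsDivFree U := hV.isDivFree (by norm_num)
  have hUenv : ∀ y, ‖U y‖ ≤ A / (‖y‖ + 1) := fun y => by
    have := hVenv (-1) (by norm_num) y
    rwa [neg_neg, Real.sqrt_one] at this
  have hUb : ∀ y, ‖U y‖ ≤ A := fun y =>
    (hUenv y).trans (div_le_self hA0 (by linarith [norm_nonneg y]))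
  have hconst : ∀ y, U y = U 0 := fun y =>
    eq_of_curl_eq_zero_of_isDivFree_of_bounded hU2 hΩ0 hdivU hUb y 0
  have hU0 : ∀ y, U y = 0 := by
    -- the constant value is killed by the envelope at infinity
    set c : EuclideanSpace ℝ (Fin 3) := U 0 with hc
    by_contra hne
    push Not at hne
    obtain ⟨y₁, hy₁⟩ := hne
    have hc0 : c ≠ 0 := by rwa [hconst y₁] at hy₁
    have hcpos : 0 < ‖c‖ := norm_pos_iff.2 hc0
    set τ : ℝ := (A / ‖c‖ + 1) / ‖c‖ with hτ
    have hτ0 : 0 ≤ τ := by positivity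
    have hny : ‖τ • c‖ = A / ‖c‖ + 1 := by
      rw [norm_smul, Real.norm_of_nonneg hτ0, hτ, div_mul_cancel₀ _ hcpos.ne']
    have h1 := hUenv (τ • c)
    rw [hconst (τ • c), hny] at h1
    have h2 : A / (A / ‖c‖ + 1 + 1) < ‖c‖ := by
      rw [div_lt_iff₀ (by positivity)]
      have : ‖c‖ * (A / ‖c‖) = A := mul_div_cancel₀ _ hcpos.ne'
      nlinarith
    linarith
  exact CalmSlice.not_singular_of_zero_slice hV (by norm_num) hU0 hVsing

/-- **THE DISSIPATION GAP.** For every Type-I constant `C` there is `ε > 0` such that no Type-I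
ancient mild solution in the KNSS gauge with constant `C` obeying `∫‖∇u(s)‖² ≤ K/√(−s)` with
`(√(max K 0)(√K_S)³)⁴ ≤ 64/27 + ε` is singular at the apex: the explicit small-dissipation threshold
of `…SmallDissipationGapSharper` is not attained (`not_singular_of_theta4_le`) and is exceeded by a
definite (ineffective) amount — if singular members existed with `θ(K_n)⁴ ↓ 64/27`, KNSS compactness
would produce one at the threshold. [cite: KochNadirashviliSereginSverak2009, §4 (arXiv:0709.3599 p. 8)] -/
theorem exists_dissipation_gap (C : ℝ) : ∃ ε : ℝ, 0 < ε ∧ ∀ K : ℝ,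
    (Real.sqrt (max K 0) *
      Real.sqrt (SNormLESNormFDerivOfEqConst (EuclideanSpace ℝ (Fin 3))
        (volume : Measure (EuclideanSpace ℝ (Fin 3))) 2 : ℝ) ^ 3) ^ 4 ≤ 64 / 27 + ε →
    ∀ u : ℝ → EuclideanSpace ℝ (Fin 3) → EuclideanSpace ℝ (Fin 3), IsTypeIAncientMild C u →
      (∀ s : ℝ, s < 0 → ∫⁻ x, ‖fderiv ℝ (u s) x‖ₑ ^ 2 ≤ ENNReal.ofReal (K / Real.sqrt (-s))) →
      ¬ (∀ r > 0, ∀ M : ℝ, ∃ t ∈ Ioo (-(r ^ 2)) (0 : ℝ),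
        ∃ x ∈ ball (0 : EuclideanSpace ℝ (Fin 3)) r, M < ‖u t x‖) := by
  set k3 : ℝ := Real.sqrt (SNormLESNormFDerivOfEqConst (EuclideanSpace ℝ (Fin 3))
    (volume : Measure (EuclideanSpace ℝ (Fin 3))) 2 : ℝ) ^ 3 with hk3
  have hk30 : 0 ≤ k3 := by positivity
  by_contra hcon
  push Not at hcon
  -- a sequence of singular members with `θ(K_n)⁴ ≤ 64/27 + 1/(n+1)`
  have hseq : ∀ n : ℕ, ∃ K : ℝ, (Real.sqrt (max K 0) * k3) ^ 4 ≤ 64 / 27 + 1 / ((n : ℝ) + 1) ∧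
      ∃ u : ℝ → EuclideanSpace ℝ (Fin 3) → EuclideanSpace ℝ (Fin 3), IsTypeIAncientMild C u ∧
        (∀ s : ℝ, s < 0 → ∫⁻ x, ‖fderiv ℝ (u s) x‖ₑ ^ 2 ≤ ENNReal.ofReal (K / Real.sqrt (-s))) ∧
        (∀ r > 0, ∀ M : ℝ, ∃ t ∈ Ioo (-(r ^ 2)) (0 : ℝ),
          ∃ x ∈ ball (0 : EuclideanSpace ℝ (Fin 3)) r, M < ‖u t x‖) := by
    intro n
    obtain ⟨K, hK, u, hu, hl, hs⟩ := hcon (1 / ((n : ℝ) + 1)) (by positivity)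
    exact ⟨K, hK, u, hu, hl, by simpa using hs⟩
  choose Kn hKn un hun hlawn hsingn using hseq
  -- each `θ(K_n)⁴ ≥ 64/27` (else the threshold theorem kills `u_n`), so `k3 > 0` and the `K_n` are
  -- bounded: `max K_n 0 ≤ K̄ := 2 / k3 ^ 2`... via `(√(max K_n 0) k3)⁴ ≤ 64/27 + 1 ≤ 4`
  have hge : ∀ n, 64 / 27 < (Real.sqrt (max (Kn n) 0) * k3) ^ 4 := fun n => by
    by_contra h
    push Not at h
    exact not_singular_of_theta4_le (hun n) (hlawn n) h (hsingn n)
  have hk3pos : 0 < k3 := by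
    rcases hk30.lt_or_eq with h | h
    · exact h
    · exfalso
      have := hge 0
      rw [← h, mul_zero] at this
      norm_num at this
  -- `x_n := √(max K_n 0) · k3` satisfies `64/27 < x_n⁴ ≤ 64/27 + 1/(n+1)`, `0 ≤ x_n`
  set x : ℕ → ℝ := fun n => Real.sqrt (max (Kn n) 0) * k3 with hx
  have hx0 : ∀ n, 0 ≤ x n := fun n => by positivity
  have hx4le : ∀ n, x n ^ 4 ≤ 64 / 27 + 1 / ((n : ℝ) + 1) := fun n => hKn n
  have hxle2 : ∀ n, x n ≤ 2 := fun n => by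
    have h1 : x n ^ 4 ≤ 2 ^ 4 := by
      have : 1 / ((n : ℝ) + 1) ≤ 1 := by
        rw [div_le_one (by positivity)]
        have : (0 : ℝ) ≤ n := n.cast_nonneg
        linarith
      linarith [hx4le n]
    exact (pow_le_pow_iff_left₀ (hx0 n) (by norm_num) (by norm_num : (4 : ℕ) ≠ 0)).1 h1
  -- the common law constant `K̄ = 4 / k3²` (`max K_n 0 = (x_n/k3)² ≤ 4/k3²`)
  set Kbar : ℝ := 4 / k3 ^ 2 with hKbar
  have hKnle : ∀ n, max (Kn n) 0 ≤ Kbar := fun n => by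
    have e : max (Kn n) 0 = (x n / k3) ^ 2 := by
      rw [hx]
      dsimp only
      rw [mul_div_cancel_right₀ _ hk3pos.ne', Real.sq_sqrt (le_max_right _ _)]
    rw [e, hKbar, div_pow, div_le_div_iff_of_pos_right (by positivity)]
    nlinarith [hxle2 n, hx0 n]
  have hlawbar : ∀ n, ∀ s : ℝ, s < 0 →
      ∫⁻ y, ‖fderiv ℝ (un n s) y‖ₑ ^ 2 ≤ ENNReal.ofReal (Kbar / Real.sqrt (-s)) := fun n s hs =>
    (hlawn n s hs).trans (ENNReal.ofReal_le_ofReal (div_le_div_of_nonneg_right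
      ((le_max_left _ _).trans (hKnle n)) (Real.sqrt_nonneg _)))
  have hlawmax : ∀ n, ∀ s : ℝ, s < 0 →
      ∫⁻ y, ‖fderiv ℝ (un n s) y‖ₑ ^ 2 ≤ ENNReal.ofReal (max (Kn n) 0 / Real.sqrt (-s)) := fun n s hs =>
    (hlawn n s hs).trans (ENNReal.ofReal_le_ofReal (div_le_div_of_nonneg_right
      (le_max_left _ _) (Real.sqrt_nonneg _)))
  -- ### compactness: a singular member AT the threshold
  obtain ⟨ψ, hψ, V, hV, hunif, hpt, hgrad⟩ := Compactness.seqLimit hun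
  have hψt : Tendsto ψ atTop atTop := hψ.tendsto_atTop
  -- the threshold constant `K_* = (64/27)^{1/2} / k3²`, `θ(K_*)⁴ = 64/27`
  set Kstar : ℝ := Real.sqrt (64 / 27) / k3 ^ 2 with hKstar
  have hKstar0 : 0 ≤ Kstar := by positivity
  have hθstar : (Real.sqrt (max Kstar 0) * k3) ^ 4 ≤ 64 / 27 := by
    rw [max_eq_left hKstar0]
    have e : (Real.sqrt Kstar * k3) ^ 4 = (Real.sqrt Kstar ^ 2) ^ 2 * k3 ^ 4 := by ring
    rw [e, Real.sq_sqrt hKstar0, hKstar, div_pow]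
    have e2 : Real.sqrt (64 / 27) ^ 2 = 64 / 27 := Real.sq_sqrt (by norm_num)
    rw [e2]
    have hk34 : k3 ^ 4 = (k3 ^ 2) ^ 2 := by ring
    rw [hk34, div_mul_cancel₀ _ (by positivity)]
  -- `max K_n 0 ≤ K_* + ε` eventually: `max K_n 0 = x_n²/k3²`, `x_n⁴ ≤ 64/27 + 1/(n+1)`
  have hKev : ∀ ε : ℝ, 0 < ε → ∀ᶠ n in atTop, max (Kn n) 0 ≤ Kstar + ε := by
    intro ε hε
    -- `x_n² ≤ √(64/27 + 1/(n+1)) ≤ √(64/27) + √(1/(n+1))`, and `√(1/(n+1)) → 0`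
    have hsmall : ∀ᶠ n : ℕ in atTop, Real.sqrt (1 / ((n : ℝ) + 1)) ≤ ε * k3 ^ 2 := by
      have h0 : Tendsto (fun n : ℕ => Real.sqrt (1 / ((n : ℝ) + 1))) atTop (𝓝 0) := by
        have h : Tendsto (fun n : ℕ => 1 / ((n : ℝ) + 1)) atTop (𝓝 0) :=
          tendsto_one_div_add_atTop_nhds_zero_nat
        have := (Real.continuous_sqrt.tendsto 0).comp h
        rwa [Real.sqrt_zero] at this
      exact (h0.eventually (ge_mem_nhds (by positivity : (0 : ℝ) < ε * k3 ^ 2))).mono fun n hn => hn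
    filter_upwards [hsmall] with n hn
    have e : max (Kn n) 0 = x n ^ 2 / k3 ^ 2 := by
      rw [hx]
      dsimp only
      rw [mul_pow, Real.sq_sqrt (le_max_right _ _), mul_div_cancel_right₀ _ (by positivity)]
    have hx2 : x n ^ 2 ≤ Real.sqrt (64 / 27) + Real.sqrt (1 / ((n : ℝ) + 1)) := by
      have h1 : x n ^ 2 ≤ Real.sqrt (64 / 27 + 1 / ((n : ℝ) + 1)) := by
        rw [Real.le_sqrt (sq_nonneg _) (by positivity)]
        calc (x n ^ 2) ^ 2 = x n ^ 4 := by ring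
          _ ≤ 64 / 27 + 1 / ((n : ℝ) + 1) := hx4le n
      have h2 : Real.sqrt (64 / 27 + 1 / ((n : ℝ) + 1)) ≤
          Real.sqrt (64 / 27) + Real.sqrt (1 / ((n : ℝ) + 1)) := by
        rw [Real.sqrt_le_iff]
        refine ⟨by positivity, ?_⟩
        nlinarith [Real.sq_sqrt (by norm_num : (0 : ℝ) ≤ 64 / 27),
          Real.sq_sqrt (by positivity : (0 : ℝ) ≤ 1 / ((n : ℝ) + 1)),
          mul_nonneg (Real.sqrt_nonneg (64 / 27 : ℝ)) (Real.sqrt_nonneg (1 / ((n : ℝ) + 1)))]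
      exact h1.trans h2
    rw [e, hKstar, div_add' _ _ _ (by positivity), div_le_div_iff_of_pos_right (by positivity)]
    nlinarith [hx2, hn]
  have hVlaw : ∀ s : ℝ, s < 0 →
      ∫⁻ y, ‖fderiv ℝ (V s) y‖ₑ ^ 2 ≤ ENNReal.ofReal (Kstar / Real.sqrt (-s)) :=
    Compactness.law_of_seqLimit (Kk := fun n => max (Kn n) 0) (Kinf := Kstar) hψt hlawmax hKev hgrad
  have hVsing := Compactness.persistent_singularity_seq (w := fun j => un (ψ j))
    (fun j => hun _) (fun j => hlawbar _) (fun j => hsingn _) hV hunif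
  exact not_singular_of_theta4_le hV hVlaw hθstar hVsing

end Summit.NavierStokesRegularity.NavierStokesRegularity.Theorems.FiniteDissipationLiouville.ThresholdK

end
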